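import Summits.BirchSwinnertonDyer.BirchSwinnertonDyer.Theses.SmallImageMuTransfer
import Literature.Barriers.BirchSwinnertonDyer.PAdicHeightNondegeneracyProofs
import Literature.NumberTheory.EllipticCurves.CanonicalPAdicHeightHolds
import Literature.NumberTheory.EllipticCurves.MordellWeilTheoremProofs
import Literature.NumberTheory.EllipticCurves.IwasawaSelmerDualProofs
import Literature.NumberTheory.EllipticCurves.KatoRankBoundProofs
import Literature.NumberTheory.EllipticCurves.Wuthrich2014.RankOneEngineProofs
import HarnessLib

/-!
# Route `SmallImageMuTransfer` (rung K6), crux `SchneiderX9RankOne` (stmt-BirchSwinnertonDyer-19631):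
# the ALGEBRAIC face of the crux — `T² ∤ char_Λ X(E/ℚ_∞)` on the rank-one X9 pairs

Helper file (`--supports stmt-BirchSwinnertonDyer-19631 --as helper`; closes nothing, proves no summit statement;
line lead bsd-line-k6-p3, gen 2).  With p606472 (ANALYTIC face: `[T¹] L_p(f, α, T) ≠ 0`, = crux 0515 on X9,
modulo Perrin-Riou 1987 Cor. 1.8 + GZK + modularity) and p608877 (HEIGHT face: `log_p(den x) ≠ 2 log_p σ_p(-x/y)`
on admissible points, modulo GZK) this records the third classical formulation of rank-one Schneider on X9,
Greenberg's "`g_E(0) ≠ 0`, i.e. `T² ∤ f_E(T)`" (LNM 1716, §4 p. 110): for a rank-one X9 pair `(W, p)`, the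
cyclotomic `ℤ_p`-extension `ℚ_∞/ℚ` (`κ` cyclotomic, `γ` a topological generator, `T = γ - 1`) and the
Pontryagin dual `X = X(E/ℚ_∞)` of `Sel_{p^∞}(E/ℚ_∞)` (any datum `D : SelmerDualData`, `Λ`-torsion), a generator
`f_E` of `char_Λ X` has a SIMPLE zero at `T = 0`.  This is the rank-one slice of the route item
`Theses.PAdicOrderV2.PAdicOrderSemisimpleR3` (stmt-BirchSwinnertonDyer-0509, `T`-semisimplicity of `X ⊗ ℚ_p`).

Kernel-checked here, all modulo Schneider's theorem `Schneider1985_order_charGenerator` (P. Schneider, Invent.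
Math. 79 (1985) / Balakrishnan–Müller–Stein 2016 Thm. 1.7: `ord_{T=0} f_E = rank E(ℚ) ↔ (Reg_p ≠ 0 ∧ Ш[p^∞]`
finite`) — conjunct 4 of the route's own `PublishedInputsX9` — and Gross–Zagier–Kolyvagin (`hGZK`, conjunct 8):

* per pair, either direction (`schneiderConjecture_of_not_sq_dvd_charGenerator`,
  `not_sq_dvd_charGenerator_of_schneiderConjecture`), through the barrier file's
  `sq_dvd_charGenerator_of_schneider1985` (an isotropic point of infinite order forces `T² ∣ f_E`) and the
  rank-one algebra `PAdicHeightData.not_schneiderConjecture_iff_of_rank_one`;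
* class level: `schneiderX9RankOne_of_exists_algebraicFace` (ONE torsion cyclotomic datum with `T² ∤ f_E`
  per rank-one X9 pair ⟹ crux, by name), `algebraicFace_of_schneiderX9RankOne` (crux ⟹ `T² ∤ f_E` for EVERY
  torsion cyclotomic datum), and the `↔` given cotorsion on X9 (`schneiderX9RankOne_iff_algebraicFace`; Kato–
  Rohrlich cotorsion, Greenberg Thm. 1.5, enters as the hypothesis `hTors` — conclusion 1 of the tree fact
  `kato_divisibility`, cf. `SelmerDualData.isTorsion_of_kato_divisibility`).

* per pair, the algebraic and analytic faces AGREE modulo the cyclotomic main conjecture in `Λ ⊗ ℚ_p`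
  (`not_sq_dvd_charGenerator_iff_coeff_one_ne_zero`; Burungale–Castella–Skinner 2025 Thm. 1.1.2 (a), the tree
  fact `burungale_castella_skinner_charIdeal_eq_padicLFunction` = conjunct 1 of `PublishedInputsX9`; `E[p]`
  irreducible and `p ≥ 5` good ordinary are inside `ClassX9`): for the normalised cyclotomic datum, any `D`,
  any generator `f_E` and any newform `f`, `T² ∤ f_E ↔ [T¹] L_p(f, α, T) ≠ 0`.

So the crux has three kernel faces on X9 with their input price tags: analytic (3 published inputs), height
(1), algebraic (2: Schneider 1985 + GZK; +cotorsion for the `∀`-form to imply the crux), pairwise equivalent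
modulo conjuncts 1, 4, 5, 8 of the route's own `PublishedInputsX9`.  None is a lever: the
residual/congruence door sees only `f_E mod p = T^λ · unit` (when `μ = 0`), i.e. proves the algebraic face at a
pair exactly when `λ(E/ℚ_∞) = 1` (crux 0515's STRATEGY-CENSUS §0 lever (a)).  HONEST FRAMING: the crux
(rank-one Schneider for non-CM `E/ℚ` at good ordinary `p ∈ {5,7}`) stays OPEN.
Sources: Greenberg LNM 1716 §4 p. 110; Schneider 1985 Thm 2′; Perrin-Riou, Bull. SMF 115 (1987) Thm 1;
Balakrishnan–Müller–Stein 2016 Thm 1.7.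
-/

-- the summit and its single problem are both named `BirchSwinnertonDyer` (registry layout D-0017)
set_option linter.dupNamespace false

set_option autoImplicit false

noncomputable section

open scoped Classical

open scoped MatrixGroups ModularForm

open CongruenceSubgroup WeierstrassCurve
open Literature.NumberTheory.EllipticCurves Literature.NumberTheory.EllipticCurves.ModularForms
  Literature.Barriers.BirchSwinnertonDyer

namespace Summit.BirchSwinnertonDyer.BirchSwinnertonDyer.Rank1Residual

/-! ### Per pair (modulo `Schneider1985_order_charGenerator`) -/

section PerPair

variable {W : WeierstrassCurve ℚ} [W.IsElliptic] [W.IsGloballyMinimal] {p : ℕ} [Fact p.Prime]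
  {κ : ZpExtension ℚ p} {γ : Field.absoluteGaloisGroup ℚ}

/-- **Simple zero of `f_E` ⟹ Schneider at the pair, in Mordell–Weil rank one** (modulo Schneider 1985,
`h85`).  `W` globally minimal, `p ≥ 5` good ordinary, `κ` cyclotomic with topological generator `γ`,
`D` a `Λ`-torsion Selmer dual datum with `char_Λ X = (f_E)`, `rank E(ℚ) = 1`, `Dh` canonical: if `T² ∤ f_E`
then `Reg_p(E, Dh) ≠ 0`.  (Were `Reg_p = 0`, a point of infinite order would be isotropic —
`not_schneiderConjecture_iff_of_rank_one` with Mordell–Weil —, and `sq_dvd_charGenerator_of_schneider1985`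
would give `T² ∣ f_E`.)  Unlike the barrier file's `Schneider1985_charGenerator_rankOne.schneiderConjecture_of_not_sq_dvd`
this takes Schneider's theorem in its BMS form plus cotorsion of the datum, and no `Ш`-finiteness.
[cite: GreenbergLNM1716, §4 p. 110 (Schneider's result, r = 1)] [cite: BalakrishnanMullerStein2015, Thm. 1.7] -/
theorem schneiderConjecture_of_not_sq_dvd_charGenerator (h85 : Schneider1985_order_charGenerator)
    (hp : 5 ≤ p) (hgood : W.HasGoodReductionAtPrime p) (hord : ¬ (p : ℤ) ∣ W.frobeniusTrace p)
    (hκ : κ.IsCyclotomic) (hγ : κ.IsTopGenerator γ) (D : W.SelmerDualData κ γ) (hX : D.IsTorsion)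
    {fE : IwasawaAlgebra p} (hfE : D.charIdeal = Ideal.span {fE}) (hr : W.mordellWeilRank = 1)
    {Dh : PAdicHeightData W p} (hDh : Dh.IsCanonical)
    (hndvd : ¬ (PowerSeries.X : IwasawaAlgebra p) ^ 2 ∣ fE) : SchneiderConjecture Dh := by
  by_contra hS
  obtain ⟨P, hP, hPP⟩ :=
    (Dh.not_schneiderConjecture_iff_of_rank_one hr W.exists_isMordellWeilBasis_holds).mp hS
  exact hndvd (sq_dvd_charGenerator_of_schneider1985 h85 hp hgood hord hκ hγ D hX hfE hr hDh hP hPP)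

/-- **Conversely (modulo Schneider 1985): Schneider at the pair and `Ш[p^∞]` finite ⟹ `T² ∤ f_E`** in
Mordell–Weil rank one: clause 2 of Schneider's theorem for an arbitrary topological generator
(`Schneider1985_order_charGenerator.order_eq_iff_of_isTopGenerator`) gives `ord_{T=0} f_E = rank E(ℚ) = 1`,
so the `T¹`-coefficient of `f_E` is non-zero. [cite: BalakrishnanMullerStein2015, Thm. 1.7]
[cite: GreenbergLNM1716, §4 p. 110 (Schneider's result, r = 1)] -/
theorem not_sq_dvd_charGenerator_of_schneiderConjecture (h85 : Schneider1985_order_charGenerator)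
    (hp : 5 ≤ p) (hgood : W.HasGoodReductionAtPrime p) (hord : ¬ (p : ℤ) ∣ W.frobeniusTrace p)
    (hκ : κ.IsCyclotomic) (hγ : κ.IsTopGenerator γ) (D : W.SelmerDualData κ γ) (hX : D.IsTorsion)
    {fE : IwasawaAlgebra p} (hfE : D.charIdeal = Ideal.span {fE}) (hr : W.mordellWeilRank = 1)
    {Dh : PAdicHeightData W p} (hDh : Dh.IsCanonical) (hS : SchneiderConjecture Dh)
    (hsha : Finite (AddCommGroup.primaryComponent W.sha p)) :
    ¬ (PowerSeries.X : IwasawaAlgebra p) ^ 2 ∣ fE := by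
  haveI : Module.Finite (IwasawaAlgebra p) D.X := D.module_finite_of_isCyclotomic W κ hκ hγ
  have horder : fE.order = W.mordellWeilRank :=
    (Schneider1985_order_charGenerator.order_eq_iff_of_isTopGenerator h85 W p hp hgood hord hκ hγ D hX
      hfE hDh).mpr ⟨hS, hsha⟩
  rw [hr] at horder
  intro hdvd
  have h2 : ((2 : ℕ) : ℕ∞) ≤ fE.order :=
    PowerSeries.nat_le_order fE 2 fun i hi ↦ (PowerSeries.X_pow_dvd_iff).mp hdvd i hi
  rw [horder] at h2
  exact absurd (ENat.coe_le_coe.mp h2) (by norm_num)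

end PerPair

/-! ### Class level: the crux in algebraic form, modulo Schneider 1985 + GZK -/

/-- **One good cyclotomic datum per rank-one X9 pair suffices (modulo Schneider 1985 + GZK).**  If every
rank-one X9 pair `(W, p)` carries SOME cyclotomic `κ` with topological generator `γ`, SOME `Λ`-torsion Selmer
dual datum `D` and a generator `f_E` of `char_Λ X` with `T² ∤ f_E`, then
`Theses.SmallImageMuTransfer.SchneiderX9RankOne` holds (by name).  `hGZK` reads `analyticRank = 1` as
`rank E(ℚ) = 1`. [cite: GreenbergLNM1716, §4 p. 110 (Schneider's result, r = 1)] -/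
theorem schneiderX9RankOne_of_exists_algebraicFace (h85 : Schneider1985_order_charGenerator)
    (hGZK : rank_eq_analyticRank_of_analyticRank_le_one)
    (h : ∀ (W : WeierstrassCurve ℚ) [W.IsElliptic] [W.IsGloballyMinimal] (p : ℕ) [Fact p.Prime],
      ClassX9 W p → W.analyticRank = 1 →
        ∃ (κ : ZpExtension ℚ p) (γ : Field.absoluteGaloisGroup ℚ) (D : W.SelmerDualData κ γ)
          (fE : IwasawaAlgebra p), κ.IsCyclotomic ∧ κ.IsTopGenerator γ ∧ D.IsTorsion ∧
            D.charIdeal = Ideal.span {fE} ∧ ¬ (PowerSeries.X : IwasawaAlgebra p) ^ 2 ∣ fE) :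
    Theses.SmallImageMuTransfer.SchneiderX9RankOne := by
  unfold Theses.SmallImageMuTransfer.SchneiderX9RankOne
  intro W _ _ p _ hX9 han Dh hDh
  obtain ⟨κ, γ, D, fE, hκ, hγ, hX, hfE, hndvd⟩ := h W p hX9 han
  have hr : W.mordellWeilRank = 1 := (hGZK W han.le).1.trans han
  exact schneiderConjecture_of_not_sq_dvd_charGenerator h85 hX9.2.1 hX9.2.2.1 hX9.2.2.2.1 hκ hγ D hX hfE
    hr hDh hndvd

/-- **The crux forces a simple zero of `f_E` for EVERY torsion cyclotomic datum of every rank-one X9 pair**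
(modulo Schneider 1985 + GZK; GZK supplies `rank E(ℚ) = 1` and `Ш` finite, and THE canonical datum exists at
`p ≥ 5` good ordinary, tree theorem `exists_isCanonical_holds`).
[cite: BalakrishnanMullerStein2015, Thm. 1.7] [cite: GreenbergLNM1716, §4 p. 110 (Schneider's result, r = 1)] -/
theorem algebraicFace_of_schneiderX9RankOne (h85 : Schneider1985_order_charGenerator)
    (hGZK : rank_eq_analyticRank_of_analyticRank_le_one)
    (h3 : Theses.SmallImageMuTransfer.SchneiderX9RankOne) :
    ∀ (W : WeierstrassCurve ℚ) [W.IsElliptic] [W.IsGloballyMinimal] (p : ℕ) [Fact p.Prime],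
      ClassX9 W p → W.analyticRank = 1 →
        ∀ (κ : ZpExtension ℚ p) (γ : Field.absoluteGaloisGroup ℚ), κ.IsCyclotomic → κ.IsTopGenerator γ →
          ∀ (D : W.SelmerDualData κ γ), D.IsTorsion → ∀ (fE : IwasawaAlgebra p),
            D.charIdeal = Ideal.span {fE} → ¬ (PowerSeries.X : IwasawaAlgebra p) ^ 2 ∣ fE := by
  unfold Theses.SmallImageMuTransfer.SchneiderX9RankOne at h3
  intro W _ _ p _ hX9 han κ γ hκ hγ D hX fE hfE
  obtain ⟨hrk, hsha⟩ := hGZK W han.le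
  have hr : W.mordellWeilRank = 1 := hrk.trans han
  haveI : Finite W.sha := hsha
  obtain ⟨Dh, hDh⟩ := exists_isCanonical_holds W p hX9.2.1 hX9.2.2.1 hX9.2.2.2.1
  exact not_sq_dvd_charGenerator_of_schneiderConjecture h85 hX9.2.1 hX9.2.2.1 hX9.2.2.2.1 hκ hγ D hX hfE hr
    hDh (h3 W p hX9 han Dh hDh) inferInstance

/-- **Crux ⟺ algebraic face (∀-form), modulo Schneider 1985 + GZK + cotorsion on X9.**  `hTors` is
Kato–Rohrlich cotorsion of `X(E/ℚ_∞)` at the X9 pairs for every cyclotomic datum (Greenberg LNM 1716 Thm. 1.5;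
in the tree: conclusion 1 of the fact `kato_divisibility`, transported by
`SelmerDualData.isTorsion_of_kato_divisibility`); it is needed only to instantiate the `∀`-form at SOME
datum (the cyclotomic `κ₀, γ₀` of `exists_isCyclotomic_isTopGenerator_isCyclotomicVariable_holds`, the datum
`nonempty_selmerDualData_holds`, a generator from `charIdeal_isPrincipal_holds`).
[cite: GreenbergLNM1716, §4 p. 110 (Schneider's result, r = 1) and Thm. 1.5] -/
theorem schneiderX9RankOne_iff_algebraicFace (h85 : Schneider1985_order_charGenerator)
    (hGZK : rank_eq_analyticRank_of_analyticRank_le_one)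
    (hTors : ∀ (W : WeierstrassCurve ℚ) [W.IsElliptic] [W.IsGloballyMinimal] (p : ℕ) [Fact p.Prime],
      ClassX9 W p → ∀ (κ : ZpExtension ℚ p) (γ : Field.absoluteGaloisGroup ℚ), κ.IsCyclotomic →
        κ.IsTopGenerator γ → ∀ (D : W.SelmerDualData κ γ), D.IsTorsion) :
    Theses.SmallImageMuTransfer.SchneiderX9RankOne ↔
      ∀ (W : WeierstrassCurve ℚ) [W.IsElliptic] [W.IsGloballyMinimal] (p : ℕ) [Fact p.Prime],
        ClassX9 W p → W.analyticRank = 1 →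
          ∀ (κ : ZpExtension ℚ p) (γ : Field.absoluteGaloisGroup ℚ), κ.IsCyclotomic → κ.IsTopGenerator γ →
            ∀ (D : W.SelmerDualData κ γ), D.IsTorsion → ∀ (fE : IwasawaAlgebra p),
              D.charIdeal = Ideal.span {fE} → ¬ (PowerSeries.X : IwasawaAlgebra p) ^ 2 ∣ fE := by
  refine ⟨algebraicFace_of_schneiderX9RankOne h85 hGZK, fun h ↦ ?_⟩
  refine schneiderX9RankOne_of_exists_algebraicFace h85 hGZK fun W _ _ p _ hX9 han ↦ ?_
  obtain ⟨κ, hκ, γ, hγ, -⟩ := exists_isCyclotomic_isTopGenerator_isCyclotomicVariable_holds p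
  obtain ⟨D⟩ := W.nonempty_selmerDualData_holds κ γ hγ
  have hP : (D.charIdeal).IsPrincipal := charIdeal_isPrincipal_holds p D.X
  have hX : D.IsTorsion := hTors W p hX9 κ γ hκ hγ D
  exact ⟨κ, γ, D, hP.generator, hκ, hγ, hX, (Ideal.span_singleton_generator D.charIdeal).symm,
    h W p hX9 han κ γ hκ hγ D hX _ (Ideal.span_singleton_generator D.charIdeal).symm⟩


/-! ### The algebraic and analytic faces agree at each pair, modulo the main conjecture in `Λ ⊗ ℚ_p` -/

section MainConjectureLink

variable {p : ℕ} [Fact p.Prime]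

/-- `T² ∣ g` in `Λ = ℤ_p⟦T⟧` iff `T² ∣ ι g` in `ℚ_p⟦T⟧` (`ι` is coefficientwise and injective).
[folklore] -/
theorem X_sq_dvd_iff_X_sq_dvd_iwasawaToPowerSeries (g : IwasawaAlgebra p) :
    (PowerSeries.X : IwasawaAlgebra p) ^ 2 ∣ g ↔
      (PowerSeries.X : PowerSeries ℚ_[p]) ^ 2 ∣ iwasawaToPowerSeries p g := by
  rw [PowerSeries.X_pow_dvd_iff, PowerSeries.X_pow_dvd_iff]
  refine forall_congr' fun m ↦ forall_congr' fun _ ↦ ?_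
  rw [PowerSeries.coeff_map]
  exact ⟨fun h ↦ by rw [h, map_zero],
    fun h ↦ (map_eq_zero_iff _ (IsFractionRing.injective ℤ_[p] ℚ_[p])).mp h⟩

/-- `T² ∣ C(c) · L ↔ T² ∣ L` for a non-zero constant `c ∈ ℚ_p`. [folklore] -/
theorem X_sq_dvd_C_mul_iff {c : ℚ_[p]} (hc : c ≠ 0) (L : PowerSeries ℚ_[p]) :
    (PowerSeries.X : PowerSeries ℚ_[p]) ^ 2 ∣ PowerSeries.C c * L ↔
      (PowerSeries.X : PowerSeries ℚ_[p]) ^ 2 ∣ L :=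
  IsUnit.dvd_mul_left ((IsUnit.mk0 c hc).map PowerSeries.C)

/-- **At a rank-one X9 pair the algebraic face IS the analytic face, modulo the cyclotomic main conjecture
in `Λ ⊗ ℚ_p`** (`hIMC` = the tree fact `burungale_castella_skinner_charIdeal_eq_padicLFunction`, Burungale–
Castella–Skinner 2025 Thm. 1.1.2 (a), conjunct 1 of the route's `PublishedInputsX9`; it needs `E[p]`
irreducible and `p ≥ 5` good ordinary — all inside `ClassX9`).  For the normalised cyclotomic datum
`(κ, γ)` (`IsCyclotomicVariable p γ`), ANY Selmer dual datum `D`, ANY generator `f_E` of `char_Λ X` and any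
newform `f` of `W`:  `T² ∤ f_E ↔ [T¹] L_p(f, α, T) ≠ 0`.  (`char X = (g)`, `ι g = p^k L_p`; `f_E ~ g`;
`T² ∣ ·` is read on the first two coefficients; `L_p(0) = 0` in analytic rank one,
`Wuthrich2014.constantCoeff_padicLFunction_eq_zero_of_analyticRank_eq_one`.)  So on X9 the three faces —
analytic (p606472), height (p608877), algebraic (this file) — are pairwise equivalent modulo conjuncts
1, 4, 5, 8 of `PublishedInputsX9`. [cite: BurungaleCastellaSkinner2025, Thm. 1.1.2 (a) (p. 2)]
[cite: MazurTateTeitelbaum1986Invent, §I.14 (14.3)] -/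
theorem not_sq_dvd_charGenerator_iff_coeff_one_ne_zero
    (hIMC : burungale_castella_skinner_charIdeal_eq_padicLFunction)
    (W : WeierstrassCurve ℚ) [W.IsElliptic] [W.IsGloballyMinimal] (hX9 : ClassX9 W p)
    (han : W.analyticRank = 1) {κ : ZpExtension ℚ p} {γ : Field.absoluteGaloisGroup ℚ}
    (hκ : κ.IsCyclotomic) (hγ : κ.IsTopGenerator γ) (hγ' : IsCyclotomicVariable p γ)
    (D : W.SelmerDualData κ γ) {fE : IwasawaAlgebra p} (hfE : D.charIdeal = Ideal.span {fE})
    {N : ℕ} [NeZero N] (f : CuspForm (Gamma0 N) 2) (hf : IsNewformOf W f) :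
    ¬ (PowerSeries.X : IwasawaAlgebra p) ^ 2 ∣ fE ↔
      PowerSeries.coeff 1 (padicLFunction f (unitRoot W p : ℚ_[p])) ≠ 0 := by
  obtain ⟨-, hp, hgood, hord, hirr, -⟩ := hX9
  obtain ⟨-, g, k, hg, hι⟩ := hIMC W p κ γ f hp hgood hord hirr hκ hγ hγ' hf D
  have hpP : p.Prime := Fact.out
  have hpk : (p : ℚ_[p]) ^ k ≠ 0 := zpow_ne_zero k (Nat.cast_ne_zero.mpr hpP.ne_zero)
  -- `f_E` and `g` generate the same ideal of the domain `Λ`, hence are associated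
  have hassoc : Associated fE g := by
    rw [← Ideal.span_singleton_eq_span_singleton, ← hfE, hg]
  have h0 : PowerSeries.coeff 0 (padicLFunction f (unitRoot W p : ℚ_[p])) = 0 := by
    rw [PowerSeries.coeff_zero_eq_constantCoeff_apply]
    exact Wuthrich2014.constantCoeff_padicLFunction_eq_zero_of_analyticRank_eq_one W p ⟨hgood, hord⟩ han
      f hf
  rw [hassoc.dvd_iff_dvd_right, X_sq_dvd_iff_X_sq_dvd_iwasawaToPowerSeries, hι,
    X_sq_dvd_C_mul_iff hpk, PowerSeries.X_pow_dvd_iff, not_iff_comm, not_not]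
  constructor
  · intro h1 m hm
    interval_cases m
    · exact h0
    · exact h1
  · intro h
    exact h 1 (by norm_num)

end MainConjectureLink

end Summit.BirchSwinnertonDyer.BirchSwinnertonDyer.Rank1Residual

end
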